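import Literature.AlgebraicGeometry.Hu2025.Proofs.S03Pluecker.Prop36
import HarnessLib

/-!
# Hu 2025 §3.3 Proposition 3.8 — DISCHARGE AS TYPED: `Prop3_8_holds` (row 101b, typer res-type-009)

**HONEST FRAMING (D-0012/D-0089).** A theorem about OUR typed transcription `Prop3_8` («the leading variable x_u of F̄_{m,u} does not appear in any
relation in 𝓕^{r−1} ∪ (𝓕^r ∖ F̄_{m,u})», chunk p0018 l.155–162, typed with `MvPolynomial.vars`); the preprint [Hu2025] stays «under review».
Proof: every variable of `F̄_{m,u'}` other than its leading variable is a BASIC variable (second index `≤ 3`) or, when `F̄_{m,u'}` has rank `1`,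
a rank-`0` leading variable (first index `≤ 3`); a leading variable `x_u` with `rank u ≥ rank u'`, `u ≠ u'`, is neither. Holds for every `n` and
every commutative `k`. AI proof, weaker than expert review; nothing here is progress on resolution of singularities.
-/

noncomputable section

namespace Literature.AlgebraicGeometry.Hu2025.Statements.S03Pluecker

open MvPolynomial

universe u

variable {n : ℕ} (k : Type u) [CommRing k]

/-- A variable of `x̄_t` has index `t`.
[cite: Hu2025, Prop. 3.8, p.39 l.25–29 (unrefereed preprint arXiv:2507.21400v1 under adjudication, D-0012/D-0089
— kernel support on OUR typed carriers of row 101; nothing of the source asserted)] -/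
theorem eq_of_mem_vars_xbar {t : ℕ × ℕ × ℕ} {x : plVar n} (hx : x ∈ (xbar k t : ChartRing n k).vars) : x.1 = t := by
  classical
  unfold xbar at hx
  split_ifs at hx with h1 h2
  · simp at hx
  · rw [mem_vars_iff_mem_support] at hx
    obtain ⟨d, hd, hxd⟩ := hx
    have hd' : d ∈ ({Finsupp.single (⟨t, h2⟩ : plVar n) 1} : Finset _) := support_monomial_subset hd
    rw [Finset.mem_singleton] at hd'
    subst hd'
    have := Finsupp.support_single_subset hxd
    rw [Finset.mem_singleton] at this
    rw [this]
  · simp at hx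

/-- Variables of a product / difference / sum (membership form).
[cite: Hu2025, Prop. 3.8, p.39 l.25–29 (unrefereed preprint arXiv:2507.21400v1 under adjudication, D-0012/D-0089
— kernel support on OUR typed carriers of row 101; nothing of the source asserted)] -/
theorem mem_vars_mul {p q : ChartRing n k} {x : plVar n} (hx : x ∈ (p * q).vars) : x ∈ p.vars ∨ x ∈ q.vars := by
  classical
  simpa [Finset.mem_union] using vars_mul p q hx

/-- Variables of `A − B + C`.
[cite: Hu2025, Prop. 3.8, p.39 l.25–29 (unrefereed preprint arXiv:2507.21400v1 under adjudication, D-0012/D-0089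
— kernel support on OUR typed carriers of row 101; nothing of the source asserted)] -/
theorem mem_vars_sac {A B C : ChartRing n k} {x : plVar n} (hx : x ∈ (A - B + C).vars) : x ∈ A.vars ∨ x ∈ B.vars ∨ x ∈ C.vars := by
  classical
  rcases Finset.mem_union.mp (vars_add_subset _ _ hx) with h | h
  · rw [sub_eq_add_neg] at h
    rcases Finset.mem_union.mp (vars_add_subset _ _ h) with h' | h'
    · exact Or.inl h'
    · rw [vars_neg] at h'
      exact Or.inr (Or.inl h')
  · exact Or.inr (Or.inr h)

/-- Variables of `A − B + C − D`.
[cite: Hu2025, Prop. 3.8, p.39 l.25–29 (unrefereed preprint arXiv:2507.21400v1 under adjudication, D-0012/D-0089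
— kernel support on OUR typed carriers of row 101; nothing of the source asserted)] -/
theorem mem_vars_sacs {A B C D : ChartRing n k} {x : plVar n} (hx : x ∈ (A - B + C - D).vars) :
    x ∈ A.vars ∨ x ∈ B.vars ∨ x ∈ C.vars ∨ x ∈ D.vars := by
  classical
  rw [sub_eq_add_neg] at hx
  rcases Finset.mem_union.mp (vars_add_subset _ _ hx) with h | h
  on_goal 2 => rw [vars_neg] at h
  · rcases mem_vars_sac k h with h' | h' | h'
    · exact Or.inl h'
    · exact Or.inr (Or.inl h')
    · exact Or.inr (Or.inr (Or.inl h'))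
  · exact Or.inr (Or.inr (Or.inr h))

/-- A variable of `x̄_s · x̄_t` has index `s` or `t`.
[cite: Hu2025, Prop. 3.8, p.39 l.25–29 (unrefereed preprint arXiv:2507.21400v1 under adjudication, D-0012/D-0089
— kernel support on OUR typed carriers of row 101; nothing of the source asserted)] -/
theorem eq_or_eq_of_mem_vars_xbar_mul {s t : ℕ × ℕ × ℕ} {x : plVar n} (hx : x ∈ (xbar k s * xbar k t : ChartRing n k).vars) :
    x.1 = s ∨ x.1 = t := by
  rcases mem_vars_mul k hx with h | h
  · exact Or.inl (eq_of_mem_vars_xbar k h)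
  · exact Or.inr (eq_of_mem_vars_xbar k h)

/-- **The variables of `F̄_{m,u'}`**: the leading variable `x_{u'}`, BASIC variables (second index `≤ 3`), and — only when `u'₁ > 3` (rank `1`) —
rank-`0` leading variables (first index `≤ 3`).
[cite: Hu2025, Prop. 3.8, p.39 l.25–29 (unrefereed preprint arXiv:2507.21400v1 under adjudication, D-0012/D-0089
— kernel support on OUR typed carriers of row 101; nothing of the source asserted)] -/
theorem index_of_mem_vars_primaryRelBar {u' : ℕ × ℕ × ℕ} (hu1 : 1 ≤ u'.1) (hlt : IsLt u') {x : plVar n}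
    (hx : x ∈ (primaryRelBar n k u').vars) : x.1 = u' ∨ x.1.2.1 ≤ 3 ∨ (3 < u'.1 ∧ x.1.1 ≤ 3) := by
  rw [primaryRelBar_eq k _ hlt] at hx
  obtain ⟨u₁, u₂, u₃⟩ := u'
  simp only at hx hu1 ⊢
  split_ifs at hx with e1 e2 e3
  · rcases mem_vars_sac k hx with h | h | h <;> rcases eq_or_eq_of_mem_vars_xbar_mul k h with h' | h' <;>
      first | (left; exact h') | (right; rw [h']; simp only [mTri]; omega)
  · rcases mem_vars_sac k hx with h | h | h <;> rcases eq_or_eq_of_mem_vars_xbar_mul k h with h' | h' <;>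
      first | (left; exact h') | (right; rw [h']; simp only [mTri]; omega)
  · rcases mem_vars_sac k hx with h | h | h <;> rcases eq_or_eq_of_mem_vars_xbar_mul k h with h' | h' <;>
      first | (left; exact h') | (right; rw [h']; simp only [mTri]; omega)
  · have h4 : 3 < u₁ := by omega
    rcases mem_vars_sacs k hx with h | h | h | h <;> rcases eq_or_eq_of_mem_vars_xbar_mul k h with h' | h' <;>
      first | (left; exact h') | (right; rw [h']; simp only [mTri]; omega)

/-- The rank of `F_{m,u}` for `u ∈ 𝕀^lt`: `1` iff `u₁ > 3`, else `0`.
[cite: Hu2025, Prop. 3.8, p.39 l.25–29 (unrefereed preprint arXiv:2507.21400v1 under adjudication, D-0012/D-0089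
— kernel support on OUR typed carriers of row 101; nothing of the source asserted)] -/
theorem rkPrimary_eq {u : ℕ × ℕ × ℕ} (hu1 : 1 ≤ u.1) (hlt : IsLt u) : rkPrimary u = if 3 < u.1 then 1 else 0 := by
  unfold rkPrimary primaryTerms
  rw [if_pos hlt]
  split_ifs <;> simp only [List.length_cons, List.length_nil] <;> omega

/-- **`Prop3_8` HOLDS** as typed (every `n`, every commutative `k`).
[cite: Hu2025, Prop. 3.8, p.39 l.25–29 (unrefereed preprint arXiv:2507.21400v1 under adjudication, D-0012/D-0089
— kernel support on OUR typed carriers of row 101; nothing of the source asserted)] -/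
theorem Prop3_8_holds : Prop3_8 n k := by
  intro u u' hlt hlt' hne hrk x hxu hx
  have h3u : 3 < u.1.2.1 := three_lt_of_isLt (n := n) u.2 hlt
  have hu1 : 1 ≤ u.1.1 := (mem_plIndexSet_iff.mp u.2).1.1
  have hu1' : 1 ≤ u'.1.1 := (mem_plIndexSet_iff.mp u'.2).1.1
  rcases index_of_mem_vars_primaryRelBar k hu1' hlt' hx with h | h | h
  · exact hne (Subtype.ext (h.symm.trans hxu))
  · rw [hxu] at h; omega
  · obtain ⟨h4', hx1⟩ := h
    rw [hxu] at hx1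
    rw [rkPrimary_eq hu1' hlt', rkPrimary_eq hu1 hlt, if_pos h4'] at hrk
    split_ifs at hrk with h4 <;> omega

end Literature.AlgebraicGeometry.Hu2025.Statements.S03Pluecker

end
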